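import Summits.QuantumFields.YangMills.Theorems.BalabanUVNodesN16Thm4ZdPrintReadouts
import HarnessLib

/-!
# Route «BalabanUVNodes» (K3 `SpineGivenEndpointR11`), DAG node N16 = NE3 — THEOREM 4 ∧ PROPOSITION 3 of [B8] AT THE ALL-TORUS MEMBER of
# n05-a's leaf family `B8LeafModelZd3.zdGF3` ⟹ N16's `ℤᵈ` READING OF THEOREM 4 WITH PRINT's (1.36)∕(1.38)∕(1.39) CONCLUSION LIST
# (`Thm4TorusAt` at period `0`, conclusion slot in the letters of file 2's Concl⁰_print, weights `(Lᵏη)^{−n}` displayed)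

Cell `pub-ymgap`, seat `pub-ymgap-dag-n16-c` (R134 fan-out seat, strategy s1; HUMAN RULING D-0062; chair R424 venue), generation 0, file 4b;
`--supports stmt-QuantumFields-19676`; `bears_on: R4∕N16 · edge N05 → N16`.

WHY.  File 3 (`…N16Thm4ZdOfLeaf`) turned the Theorem-4 clause of N05's leaf at the all-torus member into `Thm4TorusAt … Concl_T4` (Theorem
4's own list (1.62), (1.38), (1.37)).  N16's binder (file 2 `thm4TorusAt_print_of_zd`, n16-a's file 13) reads the RICHER list of Theorem 2 ∕
Proposition 3 — (1.36)₁ `|A|`, (1.36)₂ `|∇^η_{U₀}A|`, (1.38), the (1.36)₃ Hölder member, (1.39) `|Δ^η_{U₀}A|` — and NO (1.37) member, with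
uniqueness among ALL unitary gauges carrying that list.  THIS FILE supplies both differences from the leaf: EXISTENCE of the richer list is
PROPOSITION 3 (`B8.Prop3Body`, p. 87) applied to the Theorem-4 solution at the same member (its weighted suprema `msup ∕ bondNorm` of
`B8ScaledSupNorm` are genuine suprema here because (1.62) bounds the field, file 4a), and UNIQUENESS without a (1.37) clause on the competitor
is print's remark that (1.37) FOLLOWS from (1.29), (1.35)∕(1.66) and (1.36)₁ — the (1.42) lemma `B8Eq142KLevelLocal.H42_of_inAx` (§2).

WHAT THIS FILE PROVES (kernel, theorems only, 0 `def`, 0 sorry; the pointwise read-outs of the weighted suprema are file 4a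
`…N16Thm4ZdPrintReadouts`):
§2 **`thm4TorusAt_zero_print_of_leaf_member`**: `d, L ≥ 2`, an all-torus member `i` (`Ω_j = univ`, `Λs m j = {j = m}`), Hölder data `β ≥ 0`,
   `len ≥ 1` on its support; the Theorem-4 clause (constants `c₁, B₁′ > 0`) AND the Proposition-3 clause (threshold `cP`, constants `C₂`,
   `inp.B₀`, `B₀β`; output constants `B = 5dL·B₀ ≤ B₁′`, `B_h = 5dLB₀β`) of the leaf at `zdGF3 𝔸 L β len i`, and a threshold `c₁′` inside the
   displayed window ⟹ for every `Reg`: `Thm4TorusAt L i.k 0 i.η c₁′ (unitaryUnits 𝔸) Reg (Restr129 L i.k (torusLam i.k)) Concl_P`,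
   `Concl_P α₀ α₁ U₀ U′ u := ∃ A` self-adjoint, `mgauge U₀ u (cfgExp η A) = U′`, `‖A‖ ≤ Bs(Lᵏη)⁻¹`, `‖D^η_{U₀,μ}A_κ‖ ≤ Bs(Lᵏη)^{−2}`,
   `IsLandau138 L k η univ (torusLam k) U₀ A`, the Hölder member above with `B_h s`, `‖Δ^η_{U₀}A_κ‖ ≤ Bs(Lᵏη)^{−3}` (`s = α₀ + α₁`).
§3 **`thm4TorusAt_zero_print_of_leaf_univ`** ∕ **`…_of_leaf`**: the same from `B8.Thm4Body` ∧ `B8.Prop3Body` on the univ sub-family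
   `{i // i.Ω 0 = univ}` resp. on all of `ZdIdx d L`, at EVERY `k ≥ 1`, `η > 0`.
HONEST FRAMING: bookkeeping by name; Theorem 4 and Proposition 3 at curved backgrounds = node N05's theorems (in the tree only modulo n05-a's
sockets), NOT proved here; N16 ∕ NE3 NOT discharged; count-neutral; finite lattice statements — NOT ℝ⁴, NOT infinite volume, NOT OS, NOT a mass
gap, NOT Clay.
-/

set_option autoImplicit false

open scoped BigOperators
open NormedSpace

namespace Summit.QuantumFields.YangMills.BalabanUVNodes.N16.Thm4ZdPrintOfLeaf

open Literature.MathematicalPhysics.QuantumFieldTheory.Balaban1983to89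
open B7Prop1Explicit B7Prop2Explicit
open B7Prop1Local (InBox loK bondHiK)
open B7Prop3Flat (c3)
open B7Eq78Linearization (conjR)
open B7Eq92Concrete (mgauge)
open B8Ineq132 (InAk BondTouches covDerivFwd covDeriv norm_conjR_le)
open B8Eq184Proof (cfgExp)
open B8Eq119TwistedAxial (Restr129 InAx)
open B8Eq138LandauZd (IsLandau138 IsLandau138W logCfg covLap covDivB)
open B8Eq140Level (SideTouches)
open B8Eq143PlaqExpansion (norm_covDeriv_le)
open B8Eq146AExpansion (iEta)
open B7Prop4GeneralLevels (logCovIter)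
open B8Eq155JBound (gradNorm2 gradNorm2_nonneg)
open B8ScaledSupNorm (msup bondNorm weight Bdd bdd_of_forall norm_le_of_msup_le scale_pos)
open B9Eq340HolderZd (hquot AdmPair trans trans_step hquot_le_of_141)
open B8Thm4TorusAt (torusLam torusLam_self Cond166T Thm4TorusAt)
open B8Lemma1NonAbelian (mulCfg)
open B8LeafModelZd (ZdIdx)
open B8LeafModelZd3 (zdGF3 mlogCfg)
open B8LeafModelZd3NonVacuity (exists_member_univ)
open B8Prop3GaugeFixedKLevel (eq_mgauge_inv_of_mgauge_eq mem_unitaryUnits_of_mgauge_eq logField_spec mulCfg_eq_gaugeAct_of_mgauge_eq)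
open B8Thm4AtLandau138 (mgauge_mgauge_inv)
open B8Eq142KLevelLocal (H42_of_inAx)
open B12Ineq417Flat (shiftCfg)
open Thm4ZdOfLeaf (sideTouches_univ setOf_eq_torusLam inAx_torusLam_of_le avgIter_mem_unitaryUnits_of_inAk_univ avgClose_of_cond166T
  sides_of_cond166T mlogCfg_univ)
open Thm4ZdPrintReadouts (grad_pointwise_of_msup lap_pointwise_of_bondNorm holder_pointwise_of_msup)

noncomputable section

variable {d : ℕ}


/-! ## §2 The junction with print's (1.36)∕(1.38)∕(1.39) list at the all-torus member -/

section Member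

variable {𝔸 : Type} [CStarAlgebra 𝔸] [Nontrivial 𝔸]

/-- **THEOREM 4 ∧ PROPOSITION 3 OF THE LEAF AT THE ALL-TORUS MEMBER ⟹ N16's `ℤᵈ` READING WITH PRINT's CONCLUSION LIST.**  `d, L ≥ 2`; `i : ZdIdx d L`
with `Ω_j = ℤᵈ`, `Λs m j = {j = m}`; Hölder data `β ≥ 0`, `len ≥ 1` on its support; Theorem-4 constants `c₁`, `B₁′ > 0`; Proposition-3 threshold
`cP` and constants `C₂`, `inp`, `B₀β` with `B := 5dL·inp.B₀ ≤ B₁′`; a threshold `c₁′` such that `α₀ + α₁ ≤ c₁′` places `(α₀, α₁, α₂ := B₁′(α₀+α₁))`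
inside Theorem 4's, Proposition 3's ((1.61) included), Proposition 2's and the (1.42)-lemma's windows (`hwin`).  IF at the member
`zdGF3 𝔸 L β len i` the Theorem-4 clause of `B8.Thm4Body c₁ B₁′` (`hT`) and the Proposition-3 clause of `B8.Prop3Body cP d L C₂ inp B₀β` (`hP`)
hold, THEN for every `Reg`: `Thm4TorusAt L i.k 0 i.η c₁′ (unitaryUnits 𝔸) Reg (Restr129 L i.k (torusLam i.k)) Concl_P` with `Concl_P α₀ α₁ U₀ U′ u
:= ∃ A` self-adjoint, `mgauge U₀ u (cfgExp η A) = U′`, (1.36)₁ `‖A‖ ≤ Bs(Lᵏη)⁻¹`, (1.36)₂ `‖D^η_{U₀,μ}A_κ‖ ≤ Bs(Lᵏη)^{−2}`, (1.38)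
`IsLandau138 L k η univ (torusLam k) U₀ A`, (1.36)₃ `‖R(U₀(y,μ))(D_μA_κ)(y+e_μ) − (D_μA_κ)(y)‖ ≤ B_h s(Lᵏη)^{−(2+β)}(η len e_μ)^β` at admissible
pairs, (1.39)₂ `‖Δ^η_{U₀}A_κ‖ ≤ Bs(Lᵏη)^{−3}` (`s = α₀+α₁`, `B_h = 5dLB₀β`).  EXISTENCE: the leaf's Theorem-4 gauge, then its Proposition 3 at
`α₂ = B₁′s` ((1.40)₂ for `U′^{u⁻¹}U₀ = (U′U₀)^{u⁻¹}` by gauge invariance of `𝔄_k`), read pointwise (§1).  UNIQUENESS among all unitary `u′` with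
(1.29) and `Concl_P`: `A′ = (iη)⁻¹ log` of its gauge-fixed field (`logField_spec`), (1.62) with `B₁′ ≥ B`, and (1.37) for it by the (1.42)
lemma `H42_of_inAx` from (1.33), (1.34), (1.66), (1.29) — so the leaf's uniqueness clause applies.
[cite: Balaban1985RegularSpaces, Thm 4 p.88, Prop. 3 p.87, (1.36)–(1.39) pp.82–83, (1.40)–(1.42) p.83, (1.61)–(1.62) pp.86–87, (1.66) p.87, p.77 («Ω_j = T_η»)] -/
theorem thm4TorusAt_zero_print_of_leaf_member (hd2 : 2 ≤ d) {L : ℕ} (hL : 2 ≤ L) {β : ℝ} (hβ : 0 ≤ β) {len : Site d → ℝ}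
    (hlen : ∀ v : Site d, 0 < len v → 1 ≤ len v) (i : ZdIdx d L) (hΩ : ∀ j, i.Ω j = Set.univ)
    (hΛs : ∀ m j, i.Λs m j = {_y | j = m}) {c₁ c₁' B₁' cP C₂ B₀β : ℝ} {inp : B8.B9Inputs} (hB₁' : 0 < B₁')
    (hBB : 5 * (d : ℝ) * L * inp.B₀ ≤ B₁')
    (hwin : ∀ α₀ α₁ : ℝ, 0 < α₀ → 0 < α₁ → α₀ + α₁ ≤ c₁' →
      α₀ + α₁ ≤ c₁ ∧ C0 d * (2 * α₀) ≤ 1 / 3 ∧ 4 * α₀ ≤ c2' d L ∧ 16 * (B₁' * (α₀ + α₁)) ≤ 1 ∧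
      Real.exp (4 * (800 * ((d : ℝ) + 1) ^ 2 * ((d : ℝ) + 4)) * α₀) * (1 + 8 * (131072 * ((d : ℝ) + 1) ^ 2) * (B₁' * (α₀ + α₁))) ≤ 2 ∧
      2 * (B₁' * (α₀ + α₁)) ≤ c3 d L ∧ (d : ℝ) * L * α₁ ≤ 1 / 8 ∧ α₀ ≤ cP ∧ α₁ ≤ cP ∧ B₁' * (α₀ + α₁) ≤ cP ∧
      2 * (B₁' * (α₀ + α₁)) ^ 2 + 20 * d * α₀ * (B₁' * (α₀ + α₁)) + 2 * C₂ * (B₁' * (α₀ + α₁)) ^ 2 ≤ α₀ + α₁)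
    (Reg : (Site d → Fin d → 𝔸ˣ) → Prop)
    (hT : ∀ α₀ α₁ : ℝ, 0 < α₀ → 0 < α₁ → α₀ + α₁ ≤ c₁ →
      ∀ (U₀ : (zdGF3 𝔸 L β len i).Cfg) (P : (zdGF3 𝔸 L β len i).Pert),
        (zdGF3 𝔸 L β len i).InA α₀ U₀ → (zdGF3 𝔸 L β len i).Reg335 α₀ U₀ → (zdGF3 𝔸 L β len i).InAAx α₀ U₀ P →
        (zdGF3 𝔸 L β len i).avgClose166 α₁ U₀ P →
          ∃ u : (zdGF3 𝔸 L β len i).GT, (zdGF3 𝔸 L β len i).Restricted U₀ u ∧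
            ((zdGF3 𝔸 L β len i).C137 α₁ U₀ ((zdGF3 𝔸 L β len i).act P u) ∧
              (zdGF3 𝔸 L β len i).Landau U₀ ((zdGF3 𝔸 L β len i).act P u) ∧
              (zdGF3 𝔸 L β len i).C162 B₁' (α₀ + α₁) U₀ ((zdGF3 𝔸 L β len i).act P u)) ∧
            ∀ u' : (zdGF3 𝔸 L β len i).GT, (zdGF3 𝔸 L β len i).Restricted U₀ u' →
              (zdGF3 𝔸 L β len i).C137 α₁ U₀ ((zdGF3 𝔸 L β len i).act P u') →
              (zdGF3 𝔸 L β len i).Landau U₀ ((zdGF3 𝔸 L β len i).act P u') →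
              (zdGF3 𝔸 L β len i).C162 B₁' (α₀ + α₁) U₀ ((zdGF3 𝔸 L β len i).act P u') → u' = u)
    (hP : ∀ α₀ α₁ α₂ : ℝ, 0 < α₀ → α₀ ≤ cP → 0 < α₁ → α₁ ≤ cP → 0 < α₂ → α₂ ≤ cP →
      2 * α₂ ^ 2 + 20 * d * α₀ * α₂ + 2 * C₂ * α₂ ^ 2 ≤ α₀ + α₁ →
      ∀ (U₀ : (zdGF3 𝔸 L β len i).Cfg) (U₁ : (zdGF3 𝔸 L β len i).Pert),
        (zdGF3 𝔸 L β len i).InA α₀ U₀ → (zdGF3 𝔸 L β len i).Reg335 α₀ U₀ → (zdGF3 𝔸 L β len i).InAPair α₀ U₀ U₁ →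
        (zdGF3 𝔸 L β len i).C162 1 α₂ U₀ U₁ → (zdGF3 𝔸 L β len i).Landau U₀ U₁ → (zdGF3 𝔸 L β len i).C137 α₁ U₀ U₁ →
          (zdGF3 𝔸 L β len i).C136 (5 * d * (L : ℝ) * inp.B₀) (5 * d * (L : ℝ) * B₀β) (α₀ + α₁) U₀ U₁ ∧
          (zdGF3 𝔸 L β len i).C139 (5 * d * (L : ℝ) * inp.B₀) (α₀ + α₁) U₀ U₁) :
    Thm4TorusAt L i.k 0 i.η c₁' (unitaryUnits 𝔸) Reg (Restr129 L i.k (torusLam i.k))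
      (fun (α₀ α₁ : ℝ) (U₀ U' : Site d → Fin d → 𝔸ˣ) (u : Site d → 𝔸ˣ) =>
        ∃ A : Site d → Fin d → 𝔸,
          (∀ x μ, IsSelfAdjoint (A x μ)) ∧ mgauge U₀ u (cfgExp i.η A) = U' ∧
          (∀ x μ, ‖A x μ‖ ≤ 5 * (d : ℝ) * L * inp.B₀ * (α₀ + α₁) * ((L : ℝ) ^ i.k * i.η)⁻¹) ∧
          (∀ (μ : Fin d) (x : Site d) (κ : Fin d),
            ‖covDerivFwd i.η U₀ μ (fun z => A z κ) x‖ ≤ 5 * (d : ℝ) * L * inp.B₀ * (α₀ + α₁) * ((L : ℝ) ^ i.k * i.η) ^ (-(2 : ℝ))) ∧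
          IsLandau138 L i.k i.η Set.univ (torusLam i.k) U₀ A ∧
          (∀ (μ : Fin d) (y : Site d) (κ : Fin d), (y, y + e μ) ∈ AdmPair i.η len →
            ‖conjR (U₀ y μ) (covDerivFwd i.η U₀ μ (fun z => A z κ) (y + e μ)) - covDerivFwd i.η U₀ μ (fun z => A z κ) y‖
              ≤ 5 * (d : ℝ) * L * B₀β * (α₀ + α₁) * ((L : ℝ) ^ i.k * i.η) ^ (-(2 + β)) * (i.η * len (e μ)) ^ β) ∧
          (∀ (x : Site d) (κ : Fin d),
            ‖covLap i.η U₀ (fun z => A z κ) x‖ ≤ 5 * (d : ℝ) * L * inp.B₀ * (α₀ + α₁) * ((L : ℝ) ^ i.k * i.η) ^ (-(3 : ℝ)))) := by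
  intro α₀ α₁ hα₀ hα₁ hs U₀ U' hU₀G hU'G _ _ hA₀ _ hA hAx h166
  obtain ⟨hs₁, hC0', hα4, h16, hsmall, hc₃, hsmall₁, hα₀P, hα₁P, hα₂P, h61⟩ := hwin α₀ α₁ hα₀ hα₁ hs
  have hL1 : 1 ≤ L := le_trans (by norm_num) hL
  have hL1r : (1 : ℝ) ≤ L := by exact_mod_cast hL1
  have hη := i.hη
  have hB0 : 0 ≤ 5 * (d : ℝ) * L * inp.B₀ := by have := inp.B₀_pos.le; positivity
  -- the member's sets
  have hΩ' : i.Ω = fun _ => Set.univ := funext hΩ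
  have hΛs' : ∀ m, i.Λs m = torusLam m := fun m => by
    rw [← setOf_eq_torusLam m]; funext j; exact hΛs m j
  have hst : ∀ (j : ℕ) (y : Site d) (τ : Fin d), SideTouches (i.Ω j) y τ := fun j y τ => by
    rw [hΩ j]; exact sideTouches_univ hd2 y τ
  have hmlog : ∀ W : Site d → Fin d → 𝔸ˣ, mlogCfg i.k i.η i.Ω W = logCfg i.η W := mlogCfg_univ hd2 i.k i.η hΩ
  -- letters
  have hs0 : 0 < α₀ + α₁ := by linarith
  have hα₂ : 0 < B₁' * (α₀ + α₁) := mul_pos hB₁' hs0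
  have hLk : (1 : ℝ) ≤ (L : ℝ) ^ i.k := one_le_pow₀ hL1r
  have hLkη : 0 < (L : ℝ) ^ i.k * i.η := by positivity
  have hα3 : C0 d * α₀ ≤ 1 / 3 := by nlinarith [C0_pos d]
  have hU₀1 : ∀ y κ, U₀ y κ ∈ U1 𝔸 := fun y κ => unitaryUnits_le_U1 (hU₀G y κ)
  have hunit : ∀ j ≤ i.k, ∀ (x : Site d) (κ : Fin d), avgIter L U₀ j x κ ∈ unitaryUnits 𝔸 :=
    avgIter_mem_unitaryUnits_of_inAk_univ hL hα₀ hC0' hα4 hU₀G hA₀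
  -- the leaf's data at the member
  let U₀c : (zdGF3 𝔸 L β len i).Cfg := ⟨U₀, hU₀G⟩
  let P : (zdGF3 𝔸 L β len i).Pert := (U₀c, ⟨U', hU'G⟩)
  have hInA' : InAk L i.k i.η α₀ i.Ω U₀ := by rw [hΩ']; exact hA₀
  have hInA : (zdGF3 𝔸 L β len i).InA α₀ U₀c := hInA'
  have h34 : InAk L i.k i.η α₀ i.Ω (mulCfg U' U₀) := by rw [hΩ']; exact hA
  have hAx' : ∀ m, m ≤ i.k → InAx L m (i.Λs m) U₀ (mulCfg U' U₀) := fun m hm => by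
    rw [hΛs' m]; exact inAx_torusLam_of_le hL1 hm hAx
  have hInAAx : (zdGF3 𝔸 L β len i).InAAx α₀ U₀c P := ⟨rfl, h34, hAx'⟩
  have h135 : ∀ j, j ≤ i.k → ∀ (z : Site d) (μ : Fin d), (∀ x, InBox (loK L j z) (bondHiK L j z μ) x → x ∈ i.Ω j) →
      ‖(avgIter L (mulCfg U' U₀) j z μ : 𝔸) - (avgIter L U₀ j z μ : 𝔸)‖ ≤ α₁ :=
    fun j hj z μ _ => avgClose_of_cond166T h166 hunit j hj z μ
  have h166' : (zdGF3 𝔸 L β len i).avgClose166 α₁ U₀c P :=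
    ⟨h135, fun b _ => sides_of_cond166T h166 b.1 b.2⟩
  obtain ⟨u, h129, ⟨h137, hLan, h162⟩, huniq⟩ := hT α₀ α₁ hα₀ hα₁ hs₁ U₀c P hInA trivial hInAAx h166'
  -- the gauge-fixed field `W = U′^{u⁻¹}`, its logarithm `A`, and Proposition 3 at `α₂ = B₁′(α₀+α₁)`
  have hW : mgauge U₀ u.1 (mgauge U₀ u.1⁻¹ U') = U' := mgauge_mgauge_inv U₀ U' u.1
  have h162' : ∀ (y : Site d) (τ : Fin d), mgauge U₀ u.1⁻¹ U' y τ = cfgExp i.η (logCfg i.η (mgauge U₀ u.1⁻¹ U')) y τ ∧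
      IsSelfAdjoint (logCfg i.η (mgauge U₀ u.1⁻¹ U') y τ) ∧
      ‖logCfg i.η (mgauge U₀ u.1⁻¹ U') y τ‖ ≤ B₁' * (α₀ + α₁) * ((L : ℝ) ^ i.k * i.η)⁻¹ :=
    fun y τ => h162 i.k le_rfl (y, τ) (hst i.k y τ)
  have hWexp : mgauge U₀ u.1⁻¹ U' = cfgExp i.η (logCfg i.η (mgauge U₀ u.1⁻¹ U')) := by
    funext y τ; exact (h162' y τ).1
  have hui : ∀ x, u.1⁻¹ x ∈ U1 𝔸 := fun x => unitaryUnits_le_U1 ((unitaryUnits 𝔸).inv_mem (u.2.1 x))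
  have hPair : (zdGF3 𝔸 L β len i).InAPair α₀ U₀c ((zdGF3 𝔸 L β len i).act P u) := by
    show InAk L i.k i.η α₀ i.Ω (mulCfg (mgauge U₀ u.1⁻¹ U') U₀)
    rw [mulCfg_eq_gaugeAct_of_mgauge_eq hW]
    exact (B8Ineq132.inAk_gaugeAct_iff L i.k i.η α₀ i.Ω hui _).2 h34
  have h162₁ : (zdGF3 𝔸 L β len i).C162 1 (B₁' * (α₀ + α₁)) U₀c ((zdGF3 𝔸 L β len i).act P u) := by
    intro j hj b hb
    have h := h162 j hj b hb
    rwa [one_mul]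
  obtain ⟨⟨h36₁, h36₂, h36₃⟩, -, h39₂⟩ :=
    hP α₀ α₁ (B₁' * (α₀ + α₁)) hα₀ hα₀P hα₁ hα₁P hα₂ hα₂P h61 U₀c _ hInA trivial hPair h162₁ hLan h137
  -- read the output pointwise
  have hsup : ∀ (y : Site d) (τ : Fin d),
      ‖logCfg i.η (mgauge U₀ u.1⁻¹ U') y τ‖ ≤ 5 * (d : ℝ) * L * inp.B₀ * (α₀ + α₁) * ((L : ℝ) ^ i.k * i.η)⁻¹ :=
    fun y τ => (h36₁ i.k le_rfl (y, τ) (hst i.k y τ)).2.2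
  have hbd : ∀ (y : Site d) (τ : Fin d), ‖logCfg i.η (mgauge U₀ u.1⁻¹ U') y τ‖ ≤ B₁' * (α₀ + α₁) * ((L : ℝ) ^ i.k * i.η)⁻¹ :=
    fun y τ => (h162' y τ).2.2
  have h36₂' := h36₂
  change msup L i.k i.η (-(2 : ℝ)) (fun j (t : Fin d × Fin d × Site d) => SideTouches (i.Ω j) t.2.2 t.2.1)
      (fun t => covDerivFwd i.η U₀ t.1 (fun z => mlogCfg i.k i.η i.Ω (mgauge U₀ u.1⁻¹ U') z t.2.1) t.2.2)
      ≤ 5 * (d : ℝ) * L * inp.B₀ * (α₀ + α₁) at h36₂'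
  have h36₃' := h36₃
  change msup L i.k i.η (-(2 + β)) (fun j (q : Fin d × Fin d × (Site d × Site d)) => q.2.2 ∈ AdmPair i.η len ∧ q.2.2.1 ∈ i.Ω j)
      (fun q => hquot i.η β len U₀ (covDerivFwd i.η U₀ q.1 (fun z => mlogCfg i.k i.η i.Ω (mgauge U₀ u.1⁻¹ U') z q.2.1)) q.2.2)
      ≤ 5 * (d : ℝ) * L * B₀β * (α₀ + α₁) at h36₃'
  have h39₂' := h39₂
  change bondNorm L i.k i.η (-(3 : ℝ)) i.Ω
      (fun x μ => covLap i.η U₀ (fun z => mlogCfg i.k i.η i.Ω (mgauge U₀ u.1⁻¹ U') z μ) x)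
      ≤ 5 * (d : ℝ) * L * inp.B₀ * (α₀ + α₁) at h39₂'
  rw [hmlog] at h36₂' h36₃' h39₂'
  refine ⟨u.1, ⟨u.2.1, fun x j => by rw [zero_smul, add_zero], ?_, logCfg i.η (mgauge U₀ u.1⁻¹ U'),
    fun y τ => (h162' y τ).2.1, by rw [← hWexp]; exact hW, hsup,
    fun μ x κ => grad_pointwise_of_msup hd2 hL1 hη hΩ hU₀G hbd h36₂' μ x κ, ?_,
    fun μ y κ hp => holder_pointwise_of_msup hL1 hη hβ hlen hΩ hU₀G hbd h36₃' μ y κ hp,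
    fun x κ => lap_pointwise_of_bondNorm hL1 hη hΩ hU₀G hbd h39₂' x κ⟩, ?_⟩
  · -- (1.29)
    have h := h129
    change Restr129 L i.k (i.Λs i.k) U₀ u.1 at h
    rwa [hΛs'] at h
  · -- (1.38)
    have key : ∀ (S : Set (Site d)) (Λ : ℕ → Set (Site d)), S = Set.univ → Λ = torusLam i.k →
        IsLandau138 L i.k i.η S Λ U₀ (logCfg i.η (mgauge U₀ u.1⁻¹ U')) →
        IsLandau138 L i.k i.η Set.univ (torusLam i.k) U₀ (logCfg i.η (mgauge U₀ u.1⁻¹ U')) := by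
      rintro S Λ rfl rfl h; exact h
    exact key _ _ (hΩ 0) (hΛs' i.k) hLan
  · -- uniqueness among ALL unitary gauges with (1.29) and `Concl_P`
    rintro u' hu'G - hRes' ⟨A', hsa', hmg', hbd', -, hLan', -, -⟩
    let u'c : (zdGF3 𝔸 L β len i).GT := ⟨u', hu'G, fun x hx => absurd (by rw [hΩ 0]; exact Set.mem_univ x) hx⟩
    have hW'eq : mgauge U₀ u'⁻¹ U' = cfgExp i.η A' := (eq_mgauge_inv_of_mgauge_eq hmg').symm
    have hW'u : ∀ x κ, cfgExp i.η A' x κ ∈ unitaryUnits 𝔸 := mem_unitaryUnits_of_mgauge_eq hU₀G hU'G hu'G hmg'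
    -- `A′` is the logarithm of the competitor's gauge-fixed field
    have ht : 5 * (d : ℝ) * L * inp.B₀ * (α₀ + α₁) * ((L : ℝ) ^ i.k)⁻¹ ≤ 1 / 16 := by
      have h1 : 5 * (d : ℝ) * L * inp.B₀ * (α₀ + α₁) * ((L : ℝ) ^ i.k)⁻¹ ≤ B₁' * (α₀ + α₁) * 1 :=
        mul_le_mul (mul_le_mul_of_nonneg_right hBB hs0.le) (inv_le_one_of_one_le₀ hLk) (by positivity) (by positivity)
      linarith
    have hbdη : ∀ x κ, ‖A' x κ‖ ≤ 5 * (d : ℝ) * L * inp.B₀ * (α₀ + α₁) * ((L : ℝ) ^ i.k)⁻¹ * i.η⁻¹ := fun x κ => by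
      have h := hbd' x κ
      rwa [mul_inv, ← mul_assoc] at h
    have hlog : logCfg i.η (mgauge U₀ u'⁻¹ U') = A' := by
      rw [hW'eq]
      funext x κ
      exact (logField_spec hη U₀ hW'u (rfl : cfgExp i.η A' x κ = cfgExp i.η A' x κ) (hbdη x κ) ht).1
    -- the (1.62) bound with `B₁′` at every level `j ≤ k`
    have hbdj : ∀ j, j ≤ i.k → ∀ (y : Site d) (τ : Fin d), ‖A' y τ‖ ≤ B₁' * (α₀ + α₁) * ((L : ℝ) ^ j * i.η)⁻¹ := by
      intro j hj y τ
      refine (hbd' y τ).trans ?_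
      have hLj : (L : ℝ) ^ j * i.η ≤ (L : ℝ) ^ i.k * i.η :=
        mul_le_mul_of_nonneg_right (pow_le_pow_right₀ hL1r hj) hη.le
      have hLj0 : 0 < (L : ℝ) ^ j * i.η := by positivity
      exact mul_le_mul (mul_le_mul_of_nonneg_right hBB hs0.le) (inv_anti₀ hLj0 hLj) (by positivity) (by positivity)
    have hR' : (zdGF3 𝔸 L β len i).Restricted U₀c u'c := by
      show Restr129 L i.k (i.Λs i.k) U₀ u'
      rw [hΛs']; exact hRes'
    have hRes'' : Restr129 L i.k (i.Λs i.k) U₀ u' := hR'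
    -- (1.37) for the competitor by the (1.42) lemma
    have h42 := H42_of_inAx hd2 hη hL i.k hU₀G hα₀ hα₁ hα₂.le hα3 hα4 h16 hsmall hc₃ hsmall₁ i.Ω i.hΩ i.Λs i.Λb i.hbox
      i.hclass hInA' h34 hAx' h135 (fun _ _ => True) i.k i.hk le_rfl u' (mgauge U₀ u'⁻¹ U') A' hu'G
      (mgauge_mgauge_inv U₀ U' u') hRes'' trivial hsa'
      (fun j hj y τ _ => ⟨by rw [hW'eq], hbdj j hj y τ⟩)
      (fun y τ h => absurd (hst 0 y τ) (h 0 (Nat.zero_le _)))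
    have h137'' : (zdGF3 𝔸 L β len i).C137 α₁ U₀c ((zdGF3 𝔸 L β len i).act P u'c) := by
      show ∀ j, j ≤ i.k → ∀ c ∈ i.Λb i.k j,
        ‖logCovIter L U₀ (iEta i.η (mlogCfg i.k i.η i.Ω (mgauge U₀ u'⁻¹ U'))) j c.1 c.2‖ < 2 * d * L * α₁
      intro j hj c hc
      rw [hmlog, hlog]
      exact h42 j hj c hc
    have hLan'' : (zdGF3 𝔸 L β len i).Landau U₀c ((zdGF3 𝔸 L β len i).act P u'c) := by
      show IsLandau138 L i.k i.η (i.Ω 0) (i.Λs i.k) U₀ (logCfg i.η (mgauge U₀ u'⁻¹ U'))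
      rw [hlog, hΩ 0, hΛs']; exact hLan'
    have h162'' : (zdGF3 𝔸 L β len i).C162 B₁' (α₀ + α₁) U₀c ((zdGF3 𝔸 L β len i).act P u'c) := by
      show ∀ j, j ≤ i.k → ∀ b ∈ {b : Site d × Fin d | SideTouches (i.Ω j) b.1 b.2},
        mgauge U₀ u'⁻¹ U' b.1 b.2 = cfgExp i.η (logCfg i.η (mgauge U₀ u'⁻¹ U')) b.1 b.2 ∧
          IsSelfAdjoint (logCfg i.η (mgauge U₀ u'⁻¹ U') b.1 b.2) ∧
          ‖logCfg i.η (mgauge U₀ u'⁻¹ U') b.1 b.2‖ ≤ B₁' * (α₀ + α₁) * ((L : ℝ) ^ j * i.η)⁻¹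
      intro j hj b _
      rw [hlog, hW'eq]
      exact ⟨rfl, hsa' b.1 b.2, hbdj j hj b.1 b.2⟩
    have heq := huniq u'c hR' h137'' hLan'' h162''
    exact congrArg Subtype.val heq

end Member

/-! ## §3 From `B8.Thm4Body` ∧ `B8.Prop3Body` on n05-a's family, at every `k ≥ 1` and every `η > 0` -/

section Family

variable {𝔸 : Type} [CStarAlgebra 𝔸] [Nontrivial 𝔸]

/-- **N16's `ℤᵈ` READING WITH PRINT's LIST FROM THE LEAF ON THE UNIV SUB-FAMILY** (index shape `{i // i.Ω 0 = univ}` of NODE 00's family of record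
`Node00/CarriersB8.famB8OfRecord`): `B8.Thm4Body c₁ B₁′` and `B8.Prop3Body cP d L C₂ inp B₀β` on `fun i ↦ zdGF3 𝔸 L β len i.1` (as `GFData` ∕
`GFData2`), with the letters of §2, give at EVERY `k ≥ 1`, `η > 0`, for every `Reg`: `Thm4TorusAt L k 0 η c₁′ (unitaryUnits 𝔸) Reg (Restr129 L k
(torusLam k)) Concl_P` (§2 at the member of `exists_member_univ`). [cite: Balaban1985RegularSpaces, Thm 4 p.88, Prop. 3 p.87, p.77 («Ω_j = T_η»)] -/
theorem thm4TorusAt_zero_print_of_leaf_univ (hd2 : 2 ≤ d) {L : ℕ} (hL : 2 ≤ L) {β : ℝ} (hβ : 0 ≤ β) {len : Site d → ℝ}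
    (hlen : ∀ v : Site d, 0 < len v → 1 ≤ len v) {c₁ c₁' B₁' cP C₂ B₀β : ℝ} {inp : B8.B9Inputs} (hB₁' : 0 < B₁')
    (hBB : 5 * (d : ℝ) * L * inp.B₀ ≤ B₁')
    (hwin : ∀ α₀ α₁ : ℝ, 0 < α₀ → 0 < α₁ → α₀ + α₁ ≤ c₁' →
      α₀ + α₁ ≤ c₁ ∧ C0 d * (2 * α₀) ≤ 1 / 3 ∧ 4 * α₀ ≤ c2' d L ∧ 16 * (B₁' * (α₀ + α₁)) ≤ 1 ∧
      Real.exp (4 * (800 * ((d : ℝ) + 1) ^ 2 * ((d : ℝ) + 4)) * α₀) * (1 + 8 * (131072 * ((d : ℝ) + 1) ^ 2) * (B₁' * (α₀ + α₁))) ≤ 2 ∧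
      2 * (B₁' * (α₀ + α₁)) ≤ c3 d L ∧ (d : ℝ) * L * α₁ ≤ 1 / 8 ∧ α₀ ≤ cP ∧ α₁ ≤ cP ∧ B₁' * (α₀ + α₁) ≤ cP ∧
      2 * (B₁' * (α₀ + α₁)) ^ 2 + 20 * d * α₀ * (B₁' * (α₀ + α₁)) + 2 * C₂ * (B₁' * (α₀ + α₁)) ^ 2 ≤ α₀ + α₁)
    (hT : B8.Thm4Body c₁ B₁' (fun i : {i : ZdIdx d L // i.Ω 0 = Set.univ} => (zdGF3 𝔸 L β len i.1).toGFData))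
    (hP : B8.Prop3Body cP d (L : ℝ) C₂ inp B₀β (fun i : {i : ZdIdx d L // i.Ω 0 = Set.univ} => (zdGF3 𝔸 L β len i.1).toGFData2))
    {k : ℕ} (hk : 1 ≤ k) {η : ℝ} (hη : 0 < η) (Reg : (Site d → Fin d → 𝔸ˣ) → Prop) :
    Thm4TorusAt L k 0 η c₁' (unitaryUnits 𝔸) Reg (Restr129 L k (torusLam k))
      (fun (α₀ α₁ : ℝ) (U₀ U' : Site d → Fin d → 𝔸ˣ) (u : Site d → 𝔸ˣ) =>
        ∃ A : Site d → Fin d → 𝔸,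
          (∀ x μ, IsSelfAdjoint (A x μ)) ∧ mgauge U₀ u (cfgExp η A) = U' ∧
          (∀ x μ, ‖A x μ‖ ≤ 5 * (d : ℝ) * L * inp.B₀ * (α₀ + α₁) * ((L : ℝ) ^ k * η)⁻¹) ∧
          (∀ (μ : Fin d) (x : Site d) (κ : Fin d),
            ‖covDerivFwd η U₀ μ (fun z => A z κ) x‖ ≤ 5 * (d : ℝ) * L * inp.B₀ * (α₀ + α₁) * ((L : ℝ) ^ k * η) ^ (-(2 : ℝ))) ∧
          IsLandau138 L k η Set.univ (torusLam k) U₀ A ∧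
          (∀ (μ : Fin d) (y : Site d) (κ : Fin d), (y, y + e μ) ∈ AdmPair η len →
            ‖conjR (U₀ y μ) (covDerivFwd η U₀ μ (fun z => A z κ) (y + e μ)) - covDerivFwd η U₀ μ (fun z => A z κ) y‖
              ≤ 5 * (d : ℝ) * L * B₀β * (α₀ + α₁) * ((L : ℝ) ^ k * η) ^ (-(2 + β)) * (η * len (e μ)) ^ β) ∧
          (∀ (x : Site d) (κ : Fin d),
            ‖covLap η U₀ (fun z => A z κ) x‖ ≤ 5 * (d : ℝ) * L * inp.B₀ * (α₀ + α₁) * ((L : ℝ) ^ k * η) ^ (-(3 : ℝ)))) := by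
  obtain ⟨i, hΩ0, hik, hiη, hΩ, hΛs, -⟩ := exists_member_univ (d := d) (le_trans (by norm_num) hL) hk hη
  subst hik hiη
  exact thm4TorusAt_zero_print_of_leaf_member hd2 hL hβ hlen i hΩ hΛs hB₁' hBB hwin Reg (hT ⟨i, hΩ0⟩) (hP ⟨i, hΩ0⟩)

/-- **… AND FROM THE LEAF ON ALL OF `ZdIdx d L`** (the index of n05-a's `thm4Printed_zd3` ∕ `prop3Printed_zd3`): restriction to the univ sub-family.
[cite: Balaban1985RegularSpaces, Thm 4 p.88, Prop. 3 p.87, p.77] -/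
theorem thm4TorusAt_zero_print_of_leaf (hd2 : 2 ≤ d) {L : ℕ} (hL : 2 ≤ L) {β : ℝ} (hβ : 0 ≤ β) {len : Site d → ℝ}
    (hlen : ∀ v : Site d, 0 < len v → 1 ≤ len v) {c₁ c₁' B₁' cP C₂ B₀β : ℝ} {inp : B8.B9Inputs} (hB₁' : 0 < B₁')
    (hBB : 5 * (d : ℝ) * L * inp.B₀ ≤ B₁')
    (hwin : ∀ α₀ α₁ : ℝ, 0 < α₀ → 0 < α₁ → α₀ + α₁ ≤ c₁' →
      α₀ + α₁ ≤ c₁ ∧ C0 d * (2 * α₀) ≤ 1 / 3 ∧ 4 * α₀ ≤ c2' d L ∧ 16 * (B₁' * (α₀ + α₁)) ≤ 1 ∧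
      Real.exp (4 * (800 * ((d : ℝ) + 1) ^ 2 * ((d : ℝ) + 4)) * α₀) * (1 + 8 * (131072 * ((d : ℝ) + 1) ^ 2) * (B₁' * (α₀ + α₁))) ≤ 2 ∧
      2 * (B₁' * (α₀ + α₁)) ≤ c3 d L ∧ (d : ℝ) * L * α₁ ≤ 1 / 8 ∧ α₀ ≤ cP ∧ α₁ ≤ cP ∧ B₁' * (α₀ + α₁) ≤ cP ∧
      2 * (B₁' * (α₀ + α₁)) ^ 2 + 20 * d * α₀ * (B₁' * (α₀ + α₁)) + 2 * C₂ * (B₁' * (α₀ + α₁)) ^ 2 ≤ α₀ + α₁)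
    (hT : B8.Thm4Body c₁ B₁' (fun i : ZdIdx d L => (zdGF3 𝔸 L β len i).toGFData))
    (hP : B8.Prop3Body cP d (L : ℝ) C₂ inp B₀β (fun i : ZdIdx d L => (zdGF3 𝔸 L β len i).toGFData2))
    {k : ℕ} (hk : 1 ≤ k) {η : ℝ} (hη : 0 < η) (Reg : (Site d → Fin d → 𝔸ˣ) → Prop) :
    Thm4TorusAt L k 0 η c₁' (unitaryUnits 𝔸) Reg (Restr129 L k (torusLam k))
      (fun (α₀ α₁ : ℝ) (U₀ U' : Site d → Fin d → 𝔸ˣ) (u : Site d → 𝔸ˣ) =>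
        ∃ A : Site d → Fin d → 𝔸,
          (∀ x μ, IsSelfAdjoint (A x μ)) ∧ mgauge U₀ u (cfgExp η A) = U' ∧
          (∀ x μ, ‖A x μ‖ ≤ 5 * (d : ℝ) * L * inp.B₀ * (α₀ + α₁) * ((L : ℝ) ^ k * η)⁻¹) ∧
          (∀ (μ : Fin d) (x : Site d) (κ : Fin d),
            ‖covDerivFwd η U₀ μ (fun z => A z κ) x‖ ≤ 5 * (d : ℝ) * L * inp.B₀ * (α₀ + α₁) * ((L : ℝ) ^ k * η) ^ (-(2 : ℝ))) ∧
          IsLandau138 L k η Set.univ (torusLam k) U₀ A ∧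
          (∀ (μ : Fin d) (y : Site d) (κ : Fin d), (y, y + e μ) ∈ AdmPair η len →
            ‖conjR (U₀ y μ) (covDerivFwd η U₀ μ (fun z => A z κ) (y + e μ)) - covDerivFwd η U₀ μ (fun z => A z κ) y‖
              ≤ 5 * (d : ℝ) * L * B₀β * (α₀ + α₁) * ((L : ℝ) ^ k * η) ^ (-(2 + β)) * (η * len (e μ)) ^ β) ∧
          (∀ (x : Site d) (κ : Fin d),
            ‖covLap η U₀ (fun z => A z κ) x‖ ≤ 5 * (d : ℝ) * L * inp.B₀ * (α₀ + α₁) * ((L : ℝ) ^ k * η) ^ (-(3 : ℝ)))) :=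
  thm4TorusAt_zero_print_of_leaf_univ hd2 hL hβ hlen hB₁' hBB hwin (fun j => hT j.1) (fun j => hP j.1) hk hη Reg

end Family

end

end Summit.QuantumFields.YangMills.BalabanUVNodes.N16.Thm4ZdPrintOfLeaf
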